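import Summits.CriticalPhenomena.PercolationContinuityZ3.Theorems.PercNearOneGluingNoHeavyLowerTailSunflowerGradedSafe
import HarnessLib

/-!
# `NoHeavyLowerTail` (crux stmt-CriticalPhenomena-4575), abstract sunflower cubic: A-SAFETY IS MINOR-CLOSED

Support file (seat `prim-ineq-prove-1` gen 39; `--supports stmt-CriticalPhenomena-4575`).  No `sorry`, no named facts.  Memo:
run/shared/lean/prim/prim-ineq-prove-1/FINDING-GRAPHCORES-prove1-g39.md §4.

SETTING.  `μ_p = prodBernoulli p` on `Set ι` (`ι` finite); `SafeCalc.Safe p A` = Lemma A in product form for every sunflower of up-sets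
with pairwise intersections inside `A`; "A-safe" = `∀ p, Safe p A`.  The two MINORS of a core `A` at a coordinate `v`:
* `delMinor v A = {ω | ω \ {v} ∈ A}` — `A` holds with `v` switched OFF (for the up-set generated by an antichain 𝒢: the up-set generated
  by the generators avoiding `v`; it is the `p_v = 0` section);
* `conMinor v A = {ω | insert v ω ∈ A}` — `A` holds with `v` switched ON (generated by the `G \ {v}`; the `p_v = 1` section).
THEOREM (`aSafe_delMinor`, `aSafe_conMinor`): **if an up-set `A` is A-safe then so are `delMinor v A` and `conMinor v A`.**  Hence the
class of A-safe cores is closed under minors and is described by its EXCLUDED MINORS (memo §4: `maj₃ = x₁x₂ ∨ x₁x₃ ∨ x₂x₃`, the fans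
`F₄, F₅, F₆, …`, `C₅⁽³⁾`, … ; for graph cores only `maj₃ = K₃` can occur, cf. `not_aSafe_of_triangle`).
PROOF.  (1) TRANSFER (`safe_of_safe_of_eqOn`): if `X` is determined by the coordinates `≠ v` and `p, p'` agree off `v`, then
`Safe p' X → Safe p X` — split every petal `V i` into its two sections `secOn v (V i) ⊇ secOff v (V i)` (up-sets determined by the
coordinates `≠ v`, whose probabilities do not depend on `p v`: `real_eq_of_determinedBy_of_eqOn`), note that every MIXED family of
sections still meets pairwise inside `X`, expand `∏ (p_v·a_i + (1−p_v)·b_i)` (`Finset.prod_add`) and bound each of the `2ⁿ` terms by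
`Safe p' X`.  (2) At `p_v = 0`: `μ(A) = μ(delMinor v A)` and petals meeting in `delMinor v A ⊆ A` are petals for `A`; at `p_v = 1`:
replace `V i` by `V i ∩ {v ∈ ω}` (same probability, meeting inside `A`) and use `A ⊆ conMinor v A`.
-/

noncomputable section

namespace Summit.CriticalPhenomena.PercolationContinuityZ3.Theorems.SunflowerPartition

namespace SafeCalc

open MeasureTheory Finset
open Literature.Probability.LatticeModels Literature.Probability.Percolation
open TwoGenCore (wmiss)

variable {ι : Type*} [Fintype ι] [DecidableEq ι]

/-! ## Events determined by a block: the probability depends only on the parameters of the block -/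

omit [Fintype ι] in
/-- `wmiss` depends only on the parameters inside the block. [this work] -/
theorem wmiss_eq_of_eqOn {p p' : ι → unitInterval} {b : Finset ι} (h : ∀ e ∈ b, p e = p' e) {T : Finset ι} (hT : T ⊆ b) :
    wmiss p b T = wmiss p' b T := by
  unfold TwoGenCore.wmiss
  have h1 : ∏ e ∈ T, (1 - (p e : ℝ)) = ∏ e ∈ T, (1 - (p' e : ℝ)) :=
    Finset.prod_congr rfl fun e he => by rw [h e (hT he)]
  have h2 : ∏ e ∈ b \ T, (p e : ℝ) = ∏ e ∈ b \ T, (p' e : ℝ) :=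
    Finset.prod_congr rfl fun e he => by rw [h e (Finset.mem_sdiff.1 he).1]
  rw [h1, h2]

/-- The probability of an event determined by the block `b` depends only on `p` restricted to `b`. [this work] -/
theorem real_eq_of_determinedBy_of_eqOn {p p' : ι → unitInterval} {b : Finset ι} {X : Set (Set ι)}
    (hX : DeterminedBy X (↑b : Set ι)) (h : ∀ e ∈ b, p e = p' e) :
    (prodBernoulli p).real X = (prodBernoulli p').real X := by
  classical
  rw [← BEx_indicator_eq_real p hX, ← BEx_indicator_eq_real p' hX]
  unfold BEx
  refine Finset.sum_congr rfl fun T hT => ?_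
  rw [wmiss_eq_of_eqOn h (Finset.mem_powerset.1 hT)]

/-! ## Sections at one coordinate -/

/-- The section "`v` switched on": `{ω | insert v ω ∈ V}`. [this work] -/
def secOn (v : ι) (V : Set (Set ι)) : Set (Set ι) := {ω | insert v ω ∈ V}

/-- The section "`v` switched off": `{ω | ω \ {v} ∈ V}`. [this work] -/
def secOff (v : ι) (V : Set (Set ι)) : Set (Set ι) := {ω | ω \ {v} ∈ V}

omit [Fintype ι] [DecidableEq ι] in
/-- `secOn` of an up-set is an up-set. [this work] -/
theorem isUpperSet_secOn (v : ι) {V : Set (Set ι)} (hV : IsUpperSet V) : IsUpperSet (secOn v V) :=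
  fun _ _ hle hω => hV (Set.insert_subset_insert hle) hω

omit [Fintype ι] [DecidableEq ι] in
/-- `secOff` of an up-set is an up-set. [this work] -/
theorem isUpperSet_secOff (v : ι) {V : Set (Set ι)} (hV : IsUpperSet V) : IsUpperSet (secOff v V) :=
  fun _ _ hle hω => hV (fun _ hx => ⟨hle hx.1, hx.2⟩) hω

omit [Fintype ι] [DecidableEq ι] in
/-- For an up-set, `secOff ⊆ secOn` pointwise: `ω \ {v} ∈ V → insert v ω ∈ V`. [this work] -/
theorem insert_mem_of_mem_secOff (v : ι) {V : Set (Set ι)} (hV : IsUpperSet V) {ω : Set ι} (h : ω ∈ secOff v V) :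
    insert v ω ∈ V :=
  hV (fun _ hx => Set.mem_insert_of_mem v hx.1) h

/-- Two configurations that agree off `v` after inserting `v`. [this work] -/
theorem insert_inter_erase (v : ι) (ω : Set ι) :
    insert v ω ∩ (↑(univ.erase v : Finset ι) : Set ι) = ω ∩ (↑(univ.erase v : Finset ι) : Set ι) := by
  classical
  ext x
  simp only [Set.mem_inter_iff, Set.mem_insert_iff, Finset.coe_erase, Finset.coe_univ, Set.mem_sdiff, Set.mem_univ,
    Set.mem_singleton_iff, true_and]
  constructor
  · rintro ⟨h | h, hx⟩
    · exact absurd h hx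
    · exact ⟨h, hx⟩
  · rintro ⟨h, hx⟩
    exact ⟨Or.inr h, hx⟩

/-- Two configurations that agree off `v` after removing `v`. [this work] -/
theorem diff_inter_erase (v : ι) (ω : Set ι) :
    (ω \ {v}) ∩ (↑(univ.erase v : Finset ι) : Set ι) = ω ∩ (↑(univ.erase v : Finset ι) : Set ι) := by
  classical
  ext x
  simp only [Set.mem_inter_iff, Set.mem_sdiff, Set.mem_singleton_iff, Finset.coe_erase, Finset.coe_univ, Set.mem_univ,
    true_and]
  tauto

/-- `secOn v V` is determined by the coordinates other than `v`. [this work] -/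
theorem determinedBy_secOn (v : ι) (V : Set (Set ι)) : DeterminedBy (secOn v V) (↑(univ.erase v : Finset ι) : Set ι) := by
  classical
  rw [determinedBy_iff]
  intro ω ω' h
  have hins : insert v ω = insert v ω' := by
    ext x
    by_cases hx : x = v
    · subst hx; simp
    · have key := Set.ext_iff.1 h x
      simp only [Set.mem_inter_iff, Finset.coe_erase, Finset.coe_univ, Set.mem_sdiff, Set.mem_univ, Set.mem_singleton_iff,
        true_and] at key
      simp only [Set.mem_insert_iff, hx, false_or]
      exact ⟨fun h1 => (key.1 ⟨h1, hx⟩).1, fun h1 => (key.2 ⟨h1, hx⟩).1⟩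
  simp only [secOn, Set.mem_setOf_eq, hins]

/-- `secOff v V` is determined by the coordinates other than `v`. [this work] -/
theorem determinedBy_secOff (v : ι) (V : Set (Set ι)) : DeterminedBy (secOff v V) (↑(univ.erase v : Finset ι) : Set ι) := by
  classical
  rw [determinedBy_iff]
  intro ω ω' h
  have hdel : ω \ {v} = ω' \ {v} := by
    ext x
    by_cases hx : x = v
    · subst hx; simp
    · have key := Set.ext_iff.1 h x
      simp only [Set.mem_inter_iff, Finset.coe_erase, Finset.coe_univ, Set.mem_sdiff, Set.mem_univ, Set.mem_singleton_iff,
        true_and] at key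
      simp only [Set.mem_sdiff, Set.mem_singleton_iff, hx, not_false_eq_true, and_true]
      exact ⟨fun h1 => (key.1 ⟨h1, hx⟩).1, fun h1 => (key.2 ⟨h1, hx⟩).1⟩
  simp only [secOff, Set.mem_setOf_eq, hdel]

/-- **One-coordinate conditioning**: `μ(V) = p_v · μ(secOn v V) + (1 − p_v) · μ(secOff v V)`. [this work] -/
theorem real_eq_secOn_secOff (p : ι → unitInterval) (v : ι) (V : Set (Set ι)) :
    (prodBernoulli p).real V =
      (p v : ℝ) * (prodBernoulli p).real (secOn v V) + (1 - (p v : ℝ)) * (prodBernoulli p).real (secOff v V) := by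
  classical
  rw [real_eq_BEx p {v} V]
  unfold BEx
  have hps : ({v} : Finset ι).powerset = {∅, {v}} := by
    ext D
    rw [Finset.mem_powerset, Finset.subset_singleton_iff, Finset.mem_insert, Finset.mem_singleton]
  rw [hps, Finset.sum_pair (Finset.singleton_ne_empty v).symm]
  have h1 : sect {v} ∅ V = secOn v V := by
    ext ω
    simp only [sect, secOn, Set.mem_setOf_eq, Finset.sdiff_empty, Finset.coe_singleton, Set.union_singleton,
      Set.insert_sdiff_singleton]
  have h2 : sect {v} {v} V = secOff v V := by
    ext ω
    simp only [sect, secOff, Set.mem_setOf_eq, Finset.sdiff_self, Finset.coe_singleton, Finset.coe_empty,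
      Set.union_empty]
  have w1 : wmiss p {v} ∅ = (p v : ℝ) := by simp [TwoGenCore.wmiss]
  have w2 : wmiss p {v} {v} = 1 - (p v : ℝ) := by simp [TwoGenCore.wmiss]
  dsimp only
  rw [h1, h2, w1, w2]

/-! ## Transfer of safety between parameter vectors agreeing off one coordinate -/

/-- **Transfer.**  If `X` is determined by the coordinates other than `v` and `p, p'` agree off `v`, then safety of `X` for `p'`
implies safety for `p`. [this work] -/
theorem safe_of_safe_of_eqOn {p p' : ι → unitInterval} (v : ι) {X : Set (Set ι)}
    (hX : DeterminedBy X (↑(univ.erase v : Finset ι) : Set ι)) (hpp : ∀ e ∈ univ.erase v, p e = p' e) (h : Safe p' X) :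
    Safe p X := by
  classical
  intro n V hV hcap
  set a : Fin n → ℝ := fun i => (prodBernoulli p).real (secOn v (V i)) with ha
  set b : Fin n → ℝ := fun i => (prodBernoulli p).real (secOff v (V i)) with hb
  set x : ℝ := (prodBernoulli p).real X with hx
  have ha0 : ∀ i, 0 ≤ a i := fun i => measureReal_nonneg
  have hb0 : ∀ i, 0 ≤ b i := fun i => measureReal_nonneg
  have hpv0 : 0 ≤ (p v : ℝ) := (p v).2.1
  have hqv0 : 0 ≤ 1 - (p v : ℝ) := sub_nonneg.2 (p v).2.2
  -- every mixed family of sections meets pairwise inside X, so `Safe p' X` bounds it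
  have hmix : ∀ t : Finset (Fin n), (∏ i ∈ t, a i) * ∏ i ∈ univ \ t, b i ≤ x ^ (n - 1) := by
    intro t
    let W : Fin n → Set (Set ι) := fun i => if i ∈ t then secOn v (V i) else secOff v (V i)
    have hW : ∀ i, IsUpperSet (W i) := by
      intro i
      by_cases hi : i ∈ t
      · simp only [W, hi, if_true]; exact isUpperSet_secOn v (hV i)
      · simp only [W, hi, if_false]; exact isUpperSet_secOff v (hV i)
    have hins : ∀ i ω, ω ∈ W i → insert v ω ∈ V i := by
      intro i ω hω
      by_cases hi : i ∈ t
      · simp only [W, hi, if_true] at hω; exact hω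
      · simp only [W, hi, if_false] at hω; exact insert_mem_of_mem_secOff v (hV i) hω
    have hWcap : ∀ i j, i ≠ j → W i ∩ W j ⊆ X := by
      intro i j hij ω hω
      have h1 : insert v ω ∈ X := hcap i j hij ⟨hins i ω hω.1, hins j ω hω.2⟩
      exact ((determinedBy_iff X _).1 hX (insert v ω) ω (insert_inter_erase v ω)).1 h1
    have key := h n W hW hWcap
    have hWd : ∀ i, DeterminedBy (W i) (↑(univ.erase v : Finset ι) : Set ι) := by
      intro i
      by_cases hi : i ∈ t
      · simp only [W, hi, if_true]; exact determinedBy_secOn v (V i)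
      · simp only [W, hi, if_false]; exact determinedBy_secOff v (V i)
    have hWre : ∀ i, (prodBernoulli p').real (W i) = if i ∈ t then a i else b i := by
      intro i
      rw [← real_eq_of_determinedBy_of_eqOn (hWd i) hpp]
      by_cases hi : i ∈ t
      · simp only [W, hi, if_true, ha]
      · simp only [W, hi, if_false, hb]
    rw [Finset.prod_congr rfl fun i _ => hWre i, Finset.prod_ite, Finset.filter_mem_eq_inter, Finset.univ_inter,
      Finset.filter_not, Finset.filter_mem_eq_inter, Finset.univ_inter,
      ← real_eq_of_determinedBy_of_eqOn hX hpp] at key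
    exact key
  -- expand the product of the one-coordinate decompositions
  have hdec : ∀ i, (prodBernoulli p).real (V i) = (p v : ℝ) * a i + (1 - (p v : ℝ)) * b i :=
    fun i => real_eq_secOn_secOff p v (V i)
  rw [Finset.prod_congr rfl fun i _ => hdec i, Finset.prod_add]
  calc ∑ t ∈ (univ : Finset (Fin n)).powerset, (∏ i ∈ t, (p v : ℝ) * a i) * ∏ i ∈ univ \ t, (1 - (p v : ℝ)) * b i
      ≤ ∑ t ∈ (univ : Finset (Fin n)).powerset, ((∏ i ∈ t, (p v : ℝ)) * ∏ i ∈ univ \ t, (1 - (p v : ℝ))) * x ^ (n - 1) := by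
        refine Finset.sum_le_sum fun t _ => ?_
        rw [Finset.prod_mul_distrib, Finset.prod_mul_distrib]
        have hpa : 0 ≤ ∏ i ∈ t, (p v : ℝ) := Finset.prod_nonneg fun i _ => hpv0
        have hqb : 0 ≤ ∏ i ∈ univ \ t, (1 - (p v : ℝ)) := Finset.prod_nonneg fun i _ => hqv0
        calc (∏ i ∈ t, (p v : ℝ)) * (∏ i ∈ t, a i) * ((∏ i ∈ univ \ t, (1 - (p v : ℝ))) * ∏ i ∈ univ \ t, b i)
            = ((∏ i ∈ t, (p v : ℝ)) * ∏ i ∈ univ \ t, (1 - (p v : ℝ))) * ((∏ i ∈ t, a i) * ∏ i ∈ univ \ t, b i) := by ring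
          _ ≤ ((∏ i ∈ t, (p v : ℝ)) * ∏ i ∈ univ \ t, (1 - (p v : ℝ))) * x ^ (n - 1) :=
            mul_le_mul_of_nonneg_left (hmix t) (mul_nonneg hpa hqb)
    _ = (∏ _i : Fin n, ((p v : ℝ) + (1 - (p v : ℝ)))) * x ^ (n - 1) := by
        rw [← Finset.sum_mul, Finset.prod_add]
    _ = x ^ (n - 1) := by
        rw [add_sub_cancel, Finset.prod_const_one, one_mul]

/-! ## The minors -/

/-- **Deletion minor** (`v` switched off): `{ω | ω \ {v} ∈ A}`. [this work] -/
def delMinor (v : ι) (A : Set (Set ι)) : Set (Set ι) := secOff v A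

/-- **Contraction minor** (`v` switched on): `{ω | insert v ω ∈ A}`. [this work] -/
def conMinor (v : ι) (A : Set (Set ι)) : Set (Set ι) := secOn v A

omit [Fintype ι] [DecidableEq ι] in
/-- The deletion minor of an up-set lies inside it. [this work] -/
theorem delMinor_subset (v : ι) {A : Set (Set ι)} (hA : IsUpperSet A) : delMinor v A ⊆ A :=
  fun _ hω => hA (fun _ hx => hx.1) hω

omit [Fintype ι] [DecidableEq ι] in
/-- An up-set lies inside its contraction minor. [this work] -/
theorem subset_conMinor (v : ι) {A : Set (Set ι)} (hA : IsUpperSet A) : A ⊆ conMinor v A :=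
  fun _ hω => hA (Set.subset_insert v _) hω

/-- **A-safety passes to the deletion minor.** [this work] -/
theorem aSafe_delMinor {A : Set (Set ι)} (hA : IsUpperSet A) (h : ∀ p, Safe p A) (v : ι) (p : ι → unitInterval) :
    Safe p (delMinor v A) := by
  classical
  let p₀ : ι → unitInterval := Function.update p v 0
  have hpp : ∀ e ∈ univ.erase v, p e = p₀ e := fun e he =>
    (Function.update_of_ne (Finset.mem_erase.1 he).1 _ _).symm
  refine safe_of_safe_of_eqOn v (determinedBy_secOff v A) hpp ?_
  intro n V hV hcap
  have key := h p₀ n V hV fun i j hij => (hcap i j hij).trans (delMinor_subset v hA)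
  have hnull : (prodBernoulli p₀).real {ω | v ∈ ω} = 0 := by
    rw [prodBernoulli_real_setOf_mem]; simp [p₀]
  have hAeq : (prodBernoulli p₀).real A = (prodBernoulli p₀).real (delMinor v A) := by
    refine le_antisymm ?_ (measureReal_mono (delMinor_subset v hA))
    have hsub : A ⊆ delMinor v A ∪ {ω | v ∈ ω} := by
      intro ω hω
      by_cases hv : v ∈ ω
      · exact Or.inr hv
      · left
        show ω \ {v} ∈ A
        have heq : ω \ {v} = ω := by
          ext x
          simp only [Set.mem_sdiff, Set.mem_singleton_iff]
          exact ⟨fun h => h.1, fun h => ⟨h, fun hx => hv (hx ▸ h)⟩⟩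
        rwa [heq]
    calc (prodBernoulli p₀).real A ≤ (prodBernoulli p₀).real (delMinor v A ∪ {ω | v ∈ ω}) := measureReal_mono hsub
      _ ≤ (prodBernoulli p₀).real (delMinor v A) + (prodBernoulli p₀).real {ω | v ∈ ω} := measureReal_union_le _ _
      _ = (prodBernoulli p₀).real (delMinor v A) := by rw [hnull, add_zero]
  rw [hAeq] at key
  exact key

/-- **A-safety passes to the contraction minor.** [this work] -/
theorem aSafe_conMinor {A : Set (Set ι)} (hA : IsUpperSet A) (h : ∀ p, Safe p A) (v : ι) (p : ι → unitInterval) :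
    Safe p (conMinor v A) := by
  classical
  let p₁ : ι → unitInterval := Function.update p v 1
  have hpp : ∀ e ∈ univ.erase v, p e = p₁ e := fun e he =>
    (Function.update_of_ne (Finset.mem_erase.1 he).1 _ _).symm
  refine safe_of_safe_of_eqOn v (determinedBy_secOn v A) hpp ?_
  intro n V hV hcap
  -- shrink the petals to `V i ∩ {v ∈ ω}`: same probability under `p₁`, meeting inside `A`
  let V' : Fin n → Set (Set ι) := fun i => V i ∩ {ω | v ∈ ω}
  have hV' : ∀ i, IsUpperSet (V' i) := fun i => (hV i).inter fun _ _ hle hω => hle hω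
  have hcap' : ∀ i j, i ≠ j → V' i ∩ V' j ⊆ A := by
    rintro i j hij ω ⟨⟨hi, hv⟩, ⟨hj, -⟩⟩
    have h1 : ω ∈ conMinor v A := hcap i j hij ⟨hi, hj⟩
    have hv' : v ∈ ω := hv
    have h2 : insert v ω ∈ A := h1
    rwa [Set.insert_eq_of_mem hv'] at h2
  have key := h p₁ n V' hV' hcap'
  have hnull : (prodBernoulli p₁).real {ω | v ∉ ω} = 0 := by
    rw [prodBernoulli_real_setOf_notMem]; simp [p₁]
  have hVeq : ∀ i, (prodBernoulli p₁).real (V' i) = (prodBernoulli p₁).real (V i) := by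
    intro i
    refine le_antisymm (measureReal_mono Set.inter_subset_left) ?_
    have hsub : V i ⊆ V' i ∪ {ω | v ∉ ω} := by
      intro ω hω
      by_cases hv : v ∈ ω
      · exact Or.inl ⟨hω, hv⟩
      · exact Or.inr hv
    calc (prodBernoulli p₁).real (V i) ≤ (prodBernoulli p₁).real (V' i ∪ {ω | v ∉ ω}) := measureReal_mono hsub
      _ ≤ (prodBernoulli p₁).real (V' i) + (prodBernoulli p₁).real {ω | v ∉ ω} := measureReal_union_le _ _
      _ = (prodBernoulli p₁).real (V' i) := by rw [hnull, add_zero]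
  rw [Finset.prod_congr rfl fun i _ => hVeq i] at key
  exact key.trans (pow_le_pow_left₀ measureReal_nonneg (measureReal_mono (subset_conMinor v hA)) _)

/-- **A-safety is minor-closed** (both minors at once). [this work] -/
theorem aSafe_minor {A : Set (Set ι)} (hA : IsUpperSet A) (h : ∀ p, Safe p A) (v : ι) :
    (∀ p, Safe p (delMinor v A)) ∧ ∀ p, Safe p (conMinor v A) :=
  ⟨aSafe_delMinor hA h v, aSafe_conMinor hA h v⟩

end SafeCalc

end Summit.CriticalPhenomena.PercolationContinuityZ3.Theorems.SunflowerPartition
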